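import Mathlib
import Summits.ValiantsHypothesis.ValiantsHypothesis.Theses.ElementaryWordLength
import Summits.ValiantsHypothesis.ValiantsHypothesis.Theorems.ElementaryWordLengthUnboundedReadsStubSegments
import Summits.ValiantsHypothesis.ValiantsHypothesis.Theorems.ElementaryWordLengthUnboundedReadsStubUniversalCount

/-!
# Crux `ElementaryWordLength.UnboundedReads` (stmt-ValiantsHypothesis-6627) — proof

Route `ValiantsHypothesis/ElementaryWordLength`, crux item `UnboundedReads`:
for every `k` and all large `n`, every affine elementary word
`w : List (Fin 3 × Fin 3 × ℂ × Option (Fin n × Fin n))` (letters `E_{ij}(λ)`, `E_{ij}(λ x_e)`) whose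
product is the transvection `E₀₂(per_n)` reads some variable `x_e` in more than `k` letters.

Proof (line `SketchIdeator2`, lead's reshaped card `transversal-transcendence`; the two registered stubs
are the imported files):  take the transversal block `ζ i = (i, i)`, `i < b := 2(k+5)`, and
`n ≥ n₀ := 2^(b+3)`.  If every variable were read `≤ k` times, the word would have `ℓ ≤ k b` block
letters (`filter_length_le_sum`).  By `stub_segments` the `(0,2)` entry of the word product — which is
`per_n` — has a generic form in the block variables and `(ℓ+1)·3·3` parameters, so by
`stub_universalCount` (Hrubeš–Joglekar universality of the permanent plus the parameter count)
`2^b ≤ 9(ℓ+1) ≤ 9(kb+1)`, contradicting `9(kb+1) < 2^b` (`nine_mul_lt_two_pow`).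
The legality hypothesis `l.1 ≠ l.2.1` of the crux is not needed.
-/

-- `Summit.ValiantsHypothesis.ValiantsHypothesis.…` is the tree's mandated single-conjunct layout
-- (Sub = Summit), so the duplicated namespace component is intended.
set_option linter.dupNamespace false

open MvPolynomial

namespace Summit.ValiantsHypothesis.ValiantsHypothesis.Theorems.ElementaryWordLengthUnboundedReads

open Literature.Computability.AlgebraicComplexity (perPoly)

/-- Counting helper (pigeonhole over the block): if every element satisfying `P` satisfies some `Q i`,
the `P`-filter is no longer than the sum of the `Q i`-filters. [folklore] -/
theorem filter_length_le_sum {α ι : Type} [Fintype ι] [DecidableEq ι] (w : List α) (P : α → Bool)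
    (Q : ι → α → Bool) (hPQ : ∀ a, P a = true → ∃ i, Q i a = true) :
    (w.filter P).length ≤ ∑ i, (w.filter (Q i)).length := by
  induction w with
  | nil => simp
  | cons a w ih =>
    simp only [List.filter_cons]
    have hmono : ∀ j, (w.filter (Q j)).length ≤
        (if Q j a = true then a :: w.filter (Q j) else w.filter (Q j)).length := fun j => by
      split <;> simp
    by_cases hP : P a = true
    · obtain ⟨i, hi⟩ := hPQ a hP
      have hi' : (w.filter (Q i)).length + 1 ≤
          (if Q i a = true then a :: w.filter (Q i) else w.filter (Q i)).length := by simp [hi]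
      rw [if_pos hP, List.length_cons]
      calc (w.filter P).length + 1 ≤ (∑ j, (w.filter (Q j)).length) + 1 := by omega
        _ = (∑ j ∈ Finset.univ.erase i, (w.filter (Q j)).length) + ((w.filter (Q i)).length + 1) := by
            rw [← Finset.sum_erase_add _ _ (Finset.mem_univ i)]; ring
        _ ≤ (∑ j ∈ Finset.univ.erase i,
              (if Q j a = true then a :: w.filter (Q j) else w.filter (Q j)).length) +
            (if Q i a = true then a :: w.filter (Q i) else w.filter (Q i)).length :=
            add_le_add (Finset.sum_le_sum fun j _ => hmono j) hi'
        _ = ∑ j, (if Q j a = true then a :: w.filter (Q j) else w.filter (Q j)).length := by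
            rw [← Finset.sum_erase_add _ _ (Finset.mem_univ i)]
    · rw [if_neg hP]
      exact le_trans ih (Finset.sum_le_sum fun j _ => hmono j)

/-- The arithmetic of the composition: `9 (k b + 1) < 2 ^ b` for `b = 2 (k + 5)`. [folklore] -/
theorem nine_mul_lt_two_pow (k : ℕ) : 9 * (k * (2 * (k + 5)) + 1) < 2 ^ (2 * (k + 5)) := by
  have h2 : 2 ^ (2 * (k + 5)) = 2 ^ (k + 5) * 2 ^ (k + 5) := by rw [two_mul, pow_add]
  have h3 : 32 * (k + 1) ≤ 2 ^ (k + 5) := by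
    have : k + 1 ≤ 2 ^ k := Nat.lt_two_pow_self
    calc 32 * (k + 1) ≤ 32 * 2 ^ k := by omega
      _ = 2 ^ (k + 5) := by rw [pow_add]; norm_num; ring
  rw [h2]
  calc 9 * (k * (2 * (k + 5)) + 1) < 32 * (k + 1) * (32 * (k + 1)) := by nlinarith
    _ ≤ 2 ^ (k + 5) * 2 ^ (k + 5) := Nat.mul_le_mul h3 h3

/-- **Crux `UnboundedReads` of route `ElementaryWordLength` (stmt-ValiantsHypothesis-6627).**
For every `k` there is `n₀` (here `2^(2(k+5)+3)`) such that for `n ≥ n₀` every affine elementary word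
for the transvection `E₀₂(per_n)` in `E₃(ℂ[x_11, …, x_nn])` reads some variable in more than `k`
letters: bounded-read width-3 unipotent register programs do not compute the permanent.
Composition of the registered stubs `stub_segments` (generic segment form) and `stub_universalCount`
(Hrubeš–Joglekar universality + parameter count) of line `SketchIdeator2`. -/
theorem UnboundedReads_proof :
    Summit.ValiantsHypothesis.ValiantsHypothesis.Theses.ElementaryWordLength.UnboundedReads := by
  unfold Summit.ValiantsHypothesis.ValiantsHypothesis.Theses.ElementaryWordLength.UnboundedReads
  intro k
  refine ⟨2 ^ (2 * (k + 5) + 3), fun n hn w _hw hprod => ?_⟩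
  by_contra hcon
  push Not at hcon
  -- the block
  have hbn : 2 * (k + 5) ≤ n :=
    le_trans (Nat.lt_two_pow_self).le (le_trans (Nat.pow_le_pow_right two_pos (by omega)) hn)
  set ζ : Fin (2 * (k + 5)) → Fin n × Fin n := fun i => (Fin.castLE hbn i, Fin.castLE hbn i) with hζ
  have hr : Function.Injective (fun i => (ζ i).1) := fun i j h => Fin.castLE_injective hbn h
  have hc : Function.Injective (fun i => (ζ i).2) := fun i j h => Fin.castLE_injective hbn h
  -- the (0,2) entry of the word product is `per_n`
  have hper : ((w.map (fun l => Matrix.transvection l.1 l.2.1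
      (MvPolynomial.C l.2.2.1 * l.2.2.2.elim 1 MvPolynomial.X))).prod) 0 2 = perPoly (Fin n) ℂ := by
    rw [hprod]
    simp [Matrix.transvection]
  -- stub 1: the generic segment form of the word; stub 2: the count
  obtain ⟨D, hD⟩ := stub_segments n (2 * (k + 5)) ζ w
  have h2b := stub_universalCount n (2 * (k + 5)) ζ hr hc hn _ ⟨D, by rw [← hper]; exact hD⟩
  simp only [Fintype.card_prod, Fintype.card_fin] at h2b
  -- `ℓ ≤ b k` by the read bound
  have hℓ : (w.filter (fun l => decide (∃ i, l.2.2.2 = some (ζ i)))).length ≤ 2 * (k + 5) * k := by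
    calc (w.filter (fun l => decide (∃ i, l.2.2.2 = some (ζ i)))).length
        ≤ ∑ i : Fin (2 * (k + 5)), (w.filter (fun l => decide (l.2.2.2 = some (ζ i)))).length :=
          filter_length_le_sum w _ (fun i l => decide (l.2.2.2 = some (ζ i))) (by
            intro a ha
            simpa using ha)
      _ ≤ ∑ _i : Fin (2 * (k + 5)), k := Finset.sum_le_sum fun i _ => hcon (ζ i)
      _ = 2 * (k + 5) * k := by simp
  have := nine_mul_lt_two_pow k
  have h4 : ((w.filter (fun l => decide (∃ i, l.2.2.2 = some (ζ i)))).length + 1) * 3 * 3 ≤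
      9 * (k * (2 * (k + 5)) + 1) := by nlinarith
  omega

end Summit.ValiantsHypothesis.ValiantsHypothesis.Theorems.ElementaryWordLengthUnboundedReads
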